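import Mathlib
import Literature.NumberTheory.Automorphic.ZhouLegendreGreenValuesProofs
import Summits.CriticalPhenomena.PercolationContinuityZ3.Theorems.PercNearOneGluingNoHeavyLowerTailReciprocalCM
import HarnessLib

/-!
# The reflected (level `2 − γ`) Kummer partner: contiguous relations and Euler-integral positivity for `₂F₁`

Support file for the Sahi / Conjecture-P programme of route `PercNearOneGluingNoHeavy`
(`--supports stmt-CriticalPhenomena-4575`, prover prim-l12-p5 gen 41; proof note
`prim-l12-p5/PROOF-REGION-II-KUMMER-REFLECTION-g41.md` §1.3(c), §2.1 (ii)–(iii), §6.2).  No definitions, no named facts,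
no sorries.  Companion of `…LowerTailKummerReflection` (the finite framework: transfer invariance and THEOREM RII given
the partner); this file supplies the ANALYTIC facts about the partner, i.e. about Mathlib's real Gauss function
`ordinaryHypergeometric a b c g` (`|g| < 1`, non-terminating series), which the finite Gauss sums `H a c r` of the
g36–g39 files cannot express (the partner lives on the shifted lattice `m + γ − 1`):

* `hyperg_lower_fst`, `hyperg_lower_snd` — the two b-lowering contiguous relations
  `(c−β)F(β−1,α;c) = (c−α−β)F(β,α;c) + α(1−g)F(β,α+1;c)` and
  `(c−β)F(β−1,α+1;c) = (c−α−1)F(β,α;c) + (α+1−β)(1−g)F(β,α+1;c)` (termwise, via `hasSum_ordinaryHypergeometric`);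
* `hyperg_delta` — the step `F(β−1,α;c) − F(β,α;c) = −(αg/c)F(β,α+1;c+1)`;
* `hyperg_W0` — the base value of the Kummer-reflection Wronskian form,
  `(θ'+1−γ)F(1−γ,−θ';2−γ;g) − θ'F(1−γ,1−θ';2−γ;g) = (1−γ)(1−g)^{θ'}` (termwise against the binomial series);
* `hyperg_altSum_fst_nonneg` — COMPLETE MONOTONICITY IN THE FIRST PARAMETER: for `0 < b < c`, `0 ≤ g < 1`, the sequence
  `m ↦ F(a₀−m, b; c; g)` has all Hausdorff differences `≥ 0` (Euler's Beta integral
  `Literature…LegendreP.euler_integral_ordinaryHypergeometric`: it is the mixture `E[(1−gT)^{m−a₀}]`, `T ~ Beta(b, c−b)`);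
  `hyperg_pos` — strict positivity of `F(a,b;c;g)` for `0 < b < c`, `0 ≤ g < 1`; `hyperg_symm`.
With `β = 1−γ−m`, `α = −θ'`, `c = 2−γ` these are exactly the hypotheses of
`regionII_ratio_altSum_nonneg_of_partner`; the assembly (THEOREM RII unconditional) is in `…LowerTailRegionII`.
-/

namespace Summit.CriticalPhenomena.PercolationContinuityZ3.Theorems

namespace HypergeomCM


open Finset Polynomial
open Literature.NumberTheory.Automorphic.LegendreP (hasSum_ordinaryHypergeometric euler_integral_ordinaryHypergeometric
  hasSum_one_sub_rpow_neg intervalIntegrable_rpow_mul_one_sub_rpow)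

/-! ### Pochhammer bookkeeping -/

/-- Left shift of the rising factorial: `(x)_{n+1} = x · (x+1)_n`. -/
theorem poch_succ_left (x : ℝ) (n : ℕ) :
    (ascPochhammer ℝ (n + 1)).eval x = x * (ascPochhammer ℝ n).eval (x + 1) := by
  rw [ascPochhammer_succ_left, eval_mul, eval_X, eval_comp, eval_add, eval_X, eval_one]

/-- Coefficient identity behind the FIRST lowering relation `(c−β)F(β−1,α;c) = (c−α−β)F(β,α;c) + α(1−z)F(β,α+1;c)`
(index `n+1`; the `z·F` term is the shifted coefficient). -/
theorem coeff_lower_fst (α β c : ℝ) (hc : 0 < c) (n : ℕ) :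
    (c - β) * ordinaryHypergeometricCoefficient (β - 1) α c (n + 1) =
      (c - α - β) * ordinaryHypergeometricCoefficient β α c (n + 1)
        + α * ordinaryHypergeometricCoefficient β (α + 1) c (n + 1)
        - α * ordinaryHypergeometricCoefficient β (α + 1) c n := by
  simp only [ordinaryHypergeometricCoefficient]
  have e1 : (ascPochhammer ℝ (n + 1)).eval (β - 1) = (β - 1) * (ascPochhammer ℝ n).eval β := by
    rw [poch_succ_left, sub_add_cancel]
  have e2 : (ascPochhammer ℝ (n + 1)).eval α = α * (ascPochhammer ℝ n).eval (α + 1) := poch_succ_left α n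
  have e3 : (ascPochhammer ℝ (n + 1)).eval (α + 1) = (ascPochhammer ℝ n).eval (α + 1) * (α + 1 + n) :=
    ascPochhammer_succ_eval n (α + 1)
  have e4 : (ascPochhammer ℝ (n + 1)).eval β = (ascPochhammer ℝ n).eval β * (β + n) := ascPochhammer_succ_eval n β
  have e5 : (ascPochhammer ℝ (n + 1)).eval c = (ascPochhammer ℝ n).eval c * (c + n) := ascPochhammer_succ_eval n c
  rw [e1, e2, e3, e4, e5, Nat.factorial_succ]
  have hPc : (ascPochhammer ℝ n).eval c ≠ 0 := (ascPochhammer_pos n c hc).ne'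
  have hcn : c + (n : ℝ) ≠ 0 := by positivity
  have hnf : ((n.factorial : ℕ) : ℝ) ≠ 0 := by positivity
  push_cast
  field_simp
  ring

/-- Coefficient identity behind the SECOND lowering relation `(c−β)F(β−1,α+1;c) = (c−α−1)F(β,α;c) + (α+1−β)(1−z)F(β,α+1;c)`. -/
theorem coeff_lower_snd (α β c : ℝ) (hc : 0 < c) (n : ℕ) :
    (c - β) * ordinaryHypergeometricCoefficient (β - 1) (α + 1) c (n + 1) =
      (c - α - 1) * ordinaryHypergeometricCoefficient β α c (n + 1)
        + (α + 1 - β) * ordinaryHypergeometricCoefficient β (α + 1) c (n + 1)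
        - (α + 1 - β) * ordinaryHypergeometricCoefficient β (α + 1) c n := by
  simp only [ordinaryHypergeometricCoefficient]
  have e1 : (ascPochhammer ℝ (n + 1)).eval (β - 1) = (β - 1) * (ascPochhammer ℝ n).eval β := by
    rw [poch_succ_left, sub_add_cancel]
  have e2 : (ascPochhammer ℝ (n + 1)).eval α = α * (ascPochhammer ℝ n).eval (α + 1) := poch_succ_left α n
  have e3 : (ascPochhammer ℝ (n + 1)).eval (α + 1) = (ascPochhammer ℝ n).eval (α + 1) * (α + 1 + n) :=
    ascPochhammer_succ_eval n (α + 1)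
  have e4 : (ascPochhammer ℝ (n + 1)).eval β = (ascPochhammer ℝ n).eval β * (β + n) := ascPochhammer_succ_eval n β
  have e5 : (ascPochhammer ℝ (n + 1)).eval c = (ascPochhammer ℝ n).eval c * (c + n) := ascPochhammer_succ_eval n c
  rw [e1, e2, e3, e4, e5, Nat.factorial_succ]
  have hPc : (ascPochhammer ℝ n).eval c ≠ 0 := (ascPochhammer_pos n c hc).ne'
  have hcn : c + (n : ℝ) ≠ 0 := by positivity
  have hnf : ((n.factorial : ℕ) : ℝ) ≠ 0 := by positivity
  push_cast
  field_simp
  ring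

/-- Coefficient identity behind the a-step `F(β−1,α;c) − F(β,α;c) = −(αz/c)·F(β,α+1;c+1)`. -/
theorem coeff_delta (α β c : ℝ) (hc : 0 < c) (n : ℕ) :
    ordinaryHypergeometricCoefficient (β - 1) α c (n + 1) - ordinaryHypergeometricCoefficient β α c (n + 1) =
      -(α / c) * ordinaryHypergeometricCoefficient β (α + 1) (c + 1) n := by
  simp only [ordinaryHypergeometricCoefficient]
  have e1 : (ascPochhammer ℝ (n + 1)).eval (β - 1) = (β - 1) * (ascPochhammer ℝ n).eval β := by
    rw [poch_succ_left, sub_add_cancel]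
  have e2 : (ascPochhammer ℝ (n + 1)).eval α = α * (ascPochhammer ℝ n).eval (α + 1) := poch_succ_left α n
  have e4 : (ascPochhammer ℝ (n + 1)).eval β = (ascPochhammer ℝ n).eval β * (β + n) := ascPochhammer_succ_eval n β
  have e5 : (ascPochhammer ℝ (n + 1)).eval c = (ascPochhammer ℝ n).eval c * (c + n) := ascPochhammer_succ_eval n c
  have e6 : (ascPochhammer ℝ n).eval (c + 1) * c = (ascPochhammer ℝ n).eval c * (c + n) := by
    rw [← e5, poch_succ_left, mul_comm]
  rw [e1, e2, e4, e5, Nat.factorial_succ]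
  have hPc : (ascPochhammer ℝ n).eval c ≠ 0 := (ascPochhammer_pos n c hc).ne'
  have hPc1 : (ascPochhammer ℝ n).eval (c + 1) ≠ 0 := (ascPochhammer_pos n (c + 1) (by linarith)).ne'
  have hcn : c + (n : ℝ) ≠ 0 := by positivity
  have hc0 : c ≠ 0 := hc.ne'
  have hnf : ((n.factorial : ℕ) : ℝ) ≠ 0 := by positivity
  push_cast
  field_simp
  linear_combination (-((ascPochhammer ℝ n).eval β * α * (ascPochhammer ℝ n).eval (α + 1) * ((n : ℝ) + 1))) * e6

/-- Coefficient identity behind the base value `θ·F(1−γ,−θ';2−γ;g) − θ'·F(1−γ,1−θ';2−γ;g) = (1−γ)(1−g)^{θ'}`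
(`θ = θ' + 1 − γ`): termwise against the binomial series of `(1−g)^{θ'}`. -/
theorem coeff_W0 (θ' γ : ℝ) (hγ : γ < 1) (n : ℕ) :
    (θ' + 1 - γ) * ordinaryHypergeometricCoefficient (1 - γ) (-θ') (2 - γ) n
      - θ' * ordinaryHypergeometricCoefficient (1 - γ) (1 - θ') (2 - γ) n =
      (1 - γ) * ((n.factorial : ℝ)⁻¹ * (ascPochhammer ℝ n).eval (-θ')) := by
  simp only [ordinaryHypergeometricCoefficient]
  -- (1−θ')_n · (−θ') = (−θ')_n (n − θ')  and  (2−γ)_n (1−γ) = (1−γ)_n (1−γ+n)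
  have e1 : -θ' * (ascPochhammer ℝ n).eval (1 - θ') = (ascPochhammer ℝ n).eval (-θ') * (-θ' + n) := by
    rw [← ascPochhammer_succ_eval, poch_succ_left, show -θ' + 1 = 1 - θ' by ring]
  have e2 : (1 - γ) * (ascPochhammer ℝ n).eval (2 - γ) = (ascPochhammer ℝ n).eval (1 - γ) * (1 - γ + n) := by
    rw [← ascPochhammer_succ_eval, poch_succ_left, show 1 - γ + 1 = 2 - γ by ring]
  have hP2 : (ascPochhammer ℝ n).eval (2 - γ) ≠ 0 := (ascPochhammer_pos n (2 - γ) (by linarith)).ne'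
  have h1n : 1 - γ + (n : ℝ) ≠ 0 := by positivity
  have h1 : (1 : ℝ) - γ ≠ 0 := by linarith
  have hnf : ((n.factorial : ℕ) : ℝ) ≠ 0 := by positivity
  field_simp
  linear_combination ((ascPochhammer ℝ n).eval (1 - γ)) * e1 - ((ascPochhammer ℝ n).eval (-θ')) * e2

/-! ### The partner relations as identities between `₂F₁` values (|g| < 1) -/

/-- Shift helper for contiguous relations with a `z·F` term: from `HasSum (u·g^·) U`, `t 0 = 0` and the termwise identity
`t (n+1) = K·g·(u n · g^n)`, conclude `HasSum t (K·g·U)`. -/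
theorem hasSum_of_shift (t u : ℕ → ℝ) (K g U : ℝ) (hU : HasSum (fun n => u n * g ^ n) U) (h0 : t 0 = 0)
    (hsucc : ∀ n, t (n + 1) = K * g * (u n * g ^ n)) : HasSum t (K * g * U) := by
  have h1 : HasSum (fun n => t (n + 1)) (K * g * U) := by
    simp_rw [hsucc]
    exact hU.mul_left (K * g)
  have h2 : HasSum (fun n => t (n + 1)) (K * g * U - ∑ i ∈ range 1, t i) := by
    rw [sum_range_one, h0, sub_zero]
    exact h1
  exact (hasSum_nat_add_iff' 1).mp h2

/-- **First partner relation** `(c−β)·F(β−1,α;c;g) = (c−α−β)·F(β,α;c;g) + α(1−g)·F(β,α+1;c;g)` (`c > 0`, `|g| < 1`). -/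
theorem hyperg_lower_fst (α β c g : ℝ) (hc : 0 < c) (hg : |g| < 1) :
    (c - β) * ordinaryHypergeometric (β - 1) α c g =
      (c - α - β) * ordinaryHypergeometric β α c g + α * (1 - g) * ordinaryHypergeometric β (α + 1) c g := by
  have hW := hasSum_ordinaryHypergeometric (β - 1) α c hg
  have hU := hasSum_ordinaryHypergeometric β α c hg
  have hV := hasSum_ordinaryHypergeometric β (α + 1) c hg
  set t : ℕ → ℝ := fun n => (c - β) * (ordinaryHypergeometricCoefficient (β - 1) α c n * g ^ n)
    - (c - α - β) * (ordinaryHypergeometricCoefficient β α c n * g ^ n)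
    - α * (ordinaryHypergeometricCoefficient β (α + 1) c n * g ^ n) with ht
  have hT : HasSum t ((c - β) * ordinaryHypergeometric (β - 1) α c g
      - (c - α - β) * ordinaryHypergeometric β α c g - α * ordinaryHypergeometric β (α + 1) c g) :=
    ((hW.mul_left _).sub (hU.mul_left _)).sub (hV.mul_left _)
  have h0 : t 0 = 0 := by
    simp only [ht, pow_zero, mul_one, ordinaryHypergeometricCoefficient, Nat.factorial_zero, Nat.cast_one, inv_one,
      ascPochhammer_zero, eval_one]
    ring
  have hsucc : ∀ n, t (n + 1) = -α * g * (ordinaryHypergeometricCoefficient β (α + 1) c n * g ^ n) := by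
    intro n
    simp only [ht]
    have e := coeff_lower_fst α β c hc n
    rw [pow_succ]
    linear_combination (g ^ n * g) * e
  have hT' := hasSum_of_shift t _ (-α) g _ hV h0 hsucc
  have := hT.unique hT'
  linear_combination this

/-- **Second partner relation** `(c−β)·F(β−1,α+1;c;g) = (c−α−1)·F(β,α;c;g) + (α+1−β)(1−g)·F(β,α+1;c;g)`. -/
theorem hyperg_lower_snd (α β c g : ℝ) (hc : 0 < c) (hg : |g| < 1) :
    (c - β) * ordinaryHypergeometric (β - 1) (α + 1) c g =
      (c - α - 1) * ordinaryHypergeometric β α c g + (α + 1 - β) * (1 - g) * ordinaryHypergeometric β (α + 1) c g := by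
  have hW := hasSum_ordinaryHypergeometric (β - 1) (α + 1) c hg
  have hU := hasSum_ordinaryHypergeometric β α c hg
  have hV := hasSum_ordinaryHypergeometric β (α + 1) c hg
  set t : ℕ → ℝ := fun n => (c - β) * (ordinaryHypergeometricCoefficient (β - 1) (α + 1) c n * g ^ n)
    - (c - α - 1) * (ordinaryHypergeometricCoefficient β α c n * g ^ n)
    - (α + 1 - β) * (ordinaryHypergeometricCoefficient β (α + 1) c n * g ^ n) with ht
  have hT : HasSum t ((c - β) * ordinaryHypergeometric (β - 1) (α + 1) c g
      - (c - α - 1) * ordinaryHypergeometric β α c g - (α + 1 - β) * ordinaryHypergeometric β (α + 1) c g) :=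
    ((hW.mul_left _).sub (hU.mul_left _)).sub (hV.mul_left _)
  have h0 : t 0 = 0 := by
    simp only [ht, pow_zero, mul_one, ordinaryHypergeometricCoefficient, Nat.factorial_zero, Nat.cast_one, inv_one,
      ascPochhammer_zero, eval_one]
    ring
  have hsucc : ∀ n, t (n + 1) = -(α + 1 - β) * g * (ordinaryHypergeometricCoefficient β (α + 1) c n * g ^ n) := by
    intro n
    simp only [ht]
    have e := coeff_lower_snd α β c hc n
    rw [pow_succ]
    linear_combination (g ^ n * g) * e
  have hT' := hasSum_of_shift t _ (-(α + 1 - β)) g _ hV h0 hsucc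
  have := hT.unique hT'
  linear_combination this

/-- **a-step of the partner** `F(β−1,α;c;g) − F(β,α;c;g) = −(αg/c)·F(β,α+1;c+1;g)`. -/
theorem hyperg_delta (α β c g : ℝ) (hc : 0 < c) (hg : |g| < 1) :
    ordinaryHypergeometric (β - 1) α c g - ordinaryHypergeometric β α c g =
      -(α * g / c) * ordinaryHypergeometric β (α + 1) (c + 1) g := by
  have hW := hasSum_ordinaryHypergeometric (β - 1) α c hg
  have hU := hasSum_ordinaryHypergeometric β α c hg
  have hV := hasSum_ordinaryHypergeometric β (α + 1) (c + 1) hg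
  set t : ℕ → ℝ := fun n => ordinaryHypergeometricCoefficient (β - 1) α c n * g ^ n
    - ordinaryHypergeometricCoefficient β α c n * g ^ n with ht
  have hT : HasSum t (ordinaryHypergeometric (β - 1) α c g - ordinaryHypergeometric β α c g) := hW.sub hU
  have h0 : t 0 = 0 := by
    simp only [ht, pow_zero, mul_one, ordinaryHypergeometricCoefficient, Nat.factorial_zero, Nat.cast_one, inv_one,
      ascPochhammer_zero, eval_one]
    ring
  have hsucc : ∀ n, t (n + 1) = -(α / c) * g * (ordinaryHypergeometricCoefficient β (α + 1) (c + 1) n * g ^ n) := by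
    intro n
    simp only [ht]
    have e := coeff_delta α β c hc n
    rw [pow_succ]
    linear_combination (g ^ n * g) * e
  have hT' := hasSum_of_shift t _ (-(α / c)) g _ hV h0 hsucc
  have := hT.unique hT'
  rw [this]
  ring

/-- **Base value of the Wronskian form**: `(θ'+1−γ)·F(1−γ,−θ';2−γ;g) − θ'·F(1−γ,1−θ';2−γ;g) = (1−γ)(1−g)^{θ'}`
(`γ < 1`, `|g| < 1`). -/
theorem hyperg_W0 (θ' γ g : ℝ) (hγ : γ < 1) (hg : |g| < 1) :
    (θ' + 1 - γ) * ordinaryHypergeometric (1 - γ) (-θ') (2 - γ) g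
      - θ' * ordinaryHypergeometric (1 - γ) (1 - θ') (2 - γ) g = (1 - γ) * (1 - g) ^ θ' := by
  have hU := hasSum_ordinaryHypergeometric (1 - γ) (-θ') (2 - γ) hg
  have hV := hasSum_ordinaryHypergeometric (1 - γ) (1 - θ') (2 - γ) hg
  have hB := hasSum_one_sub_rpow_neg (-θ') hg
  rw [neg_neg] at hB
  have hL : HasSum (fun n => (θ' + 1 - γ) * (ordinaryHypergeometricCoefficient (1 - γ) (-θ') (2 - γ) n * g ^ n)
      - θ' * (ordinaryHypergeometricCoefficient (1 - γ) (1 - θ') (2 - γ) n * g ^ n))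
      ((θ' + 1 - γ) * ordinaryHypergeometric (1 - γ) (-θ') (2 - γ) g
        - θ' * ordinaryHypergeometric (1 - γ) (1 - θ') (2 - γ) g) := (hU.mul_left _).sub (hV.mul_left _)
  have hR : HasSum (fun n => (θ' + 1 - γ) * (ordinaryHypergeometricCoefficient (1 - γ) (-θ') (2 - γ) n * g ^ n)
      - θ' * (ordinaryHypergeometricCoefficient (1 - γ) (1 - θ') (2 - γ) n * g ^ n)) ((1 - γ) * (1 - g) ^ θ') := by
    have h := hB.mul_left (1 - γ)
    have key : (fun n : ℕ => (θ' + 1 - γ) * (ordinaryHypergeometricCoefficient (1 - γ) (-θ') (2 - γ) n * g ^ n)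
        - θ' * (ordinaryHypergeometricCoefficient (1 - γ) (1 - θ') (2 - γ) n * g ^ n)) =
        fun n : ℕ => (1 - γ) * ((n.factorial : ℝ)⁻¹ * (ascPochhammer ℝ n).eval (-θ') * g ^ n) := by
      funext n
      have e := coeff_W0 θ' γ hγ n
      linear_combination (g ^ n) * e
    rw [key]
    exact h
  exact hL.unique hR


/-! ### Euler integrals: positivity and complete monotonicity in the first parameter -/

/-- Symmetry `F(a,b;c;x) = F(b,a;c;x)`. -/
theorem hyperg_symm (a b c x : ℝ) : ordinaryHypergeometric a b c x = ordinaryHypergeometric b a c x := by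
  rw [Literature.NumberTheory.Automorphic.LegendreP.ordinaryHypergeometric_eq_tsum_mul_pow,
    Literature.NumberTheory.Automorphic.LegendreP.ordinaryHypergeometric_eq_tsum_mul_pow]
  refine tsum_congr fun n => ?_
  simp only [ordinaryHypergeometricCoefficient]
  ring

/-- For `t ∈ [0,1]` and `0 ≤ g < 1`: `0 < 1 − g t`. -/
theorem one_sub_mul_pos_of {g : ℝ} (hg0 : 0 ≤ g) (hg1 : g < 1) {t : ℝ} (ht : t ∈ Set.Icc (0 : ℝ) 1) : 0 < 1 - g * t := by
  have : g * t ≤ g * 1 := by gcongr; exact ht.2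
  linarith

/-- The Euler kernel `t^{b−1}(1−t)^{c−b−1}(1−gt)^{s}` is integrable on `[0,1]` (`0 < b < c`, `0 ≤ g < 1`). -/
theorem intervalIntegrable_euler (b c g s : ℝ) (hb : 0 < b) (hbc : b < c) (hg0 : 0 ≤ g) (hg1 : g < 1) :
    IntervalIntegrable (fun t : ℝ => t ^ (b - 1) * (1 - t) ^ (c - b - 1) * (1 - g * t) ^ s)
      MeasureTheory.volume 0 1 := by
  have hw := intervalIntegrable_rpow_mul_one_sub_rpow hb (sub_pos.2 hbc)
  refine hw.mul_continuousOn ?_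
  have hc : ContinuousOn (fun t : ℝ => 1 - g * t) (Set.uIcc (0 : ℝ) 1) := by fun_prop
  refine hc.rpow_const fun t ht => Or.inl ?_
  rw [Set.uIcc_of_le zero_le_one] at ht
  exact (one_sub_mul_pos_of hg0 hg1 ht).ne'

/-- Euler's integral solved for `F`: `F(a,b;c;g) = Γ(c)/(Γ(b)Γ(c−b)) · ∫₀¹ t^{b−1}(1−t)^{c−b−1}(1−gt)^{−a} dt`. -/
theorem hyperg_eq_const_mul_integral (a b c g : ℝ) (hb : 0 < b) (hbc : b < c) (hg : |g| < 1) :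
    ordinaryHypergeometric a b c g = Real.Gamma c / (Real.Gamma b * Real.Gamma (c - b)) *
      ∫ t in (0 : ℝ)..1, t ^ (b - 1) * (1 - t) ^ (c - b - 1) * (1 - g * t) ^ (-a) := by
  have h := euler_integral_ordinaryHypergeometric (a := a) hb hbc hg
  have hΓb := Real.Gamma_pos_of_pos hb
  have hΓcb := Real.Gamma_pos_of_pos (sub_pos.2 hbc)
  have hΓc := Real.Gamma_pos_of_pos (hb.trans hbc)
  rw [h]
  field_simp

/-- **Complete monotonicity in the first parameter**: for `0 < b < c`, `0 ≤ g < 1` and any `a₀`, the sequence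
`m ↦ F(a₀ − m, b; c; g)` has all Hausdorff differences `≥ 0` (it is the mixture `E[(1−gT)^{m−a₀}]`, `T ~ Beta(b,c−b)`). -/
theorem hyperg_altSum_fst_nonneg (a₀ b c g : ℝ) (hb : 0 < b) (hbc : b < c) (hg0 : 0 ≤ g) (hg1 : g < 1) (k j : ℕ) :
    0 ≤ ∑ i ∈ range (k + 1), (-1 : ℝ) ^ i * (k.choose i : ℝ) *
      ordinaryHypergeometric (a₀ - ((j + i : ℕ) : ℝ)) b c g := by
  have hg : |g| < 1 := abs_lt.2 ⟨by linarith, hg1⟩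
  set K : ℝ := Real.Gamma c / (Real.Gamma b * Real.Gamma (c - b)) with hKdef
  have hK : 0 ≤ K := by
    have hΓb := Real.Gamma_pos_of_pos hb
    have hΓcb := Real.Gamma_pos_of_pos (sub_pos.2 hbc)
    have hΓc := Real.Gamma_pos_of_pos (hb.trans hbc)
    positivity
  set f : ℕ → ℝ → ℝ := fun i t =>
    (-1 : ℝ) ^ i * (k.choose i : ℝ) * (t ^ (b - 1) * (1 - t) ^ (c - b - 1) * (1 - g * t) ^ (-(a₀ - ((j + i : ℕ) : ℝ))))
    with hfdef
  have hterm : ∀ i ∈ range (k + 1), (-1 : ℝ) ^ i * (k.choose i : ℝ) *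
      ordinaryHypergeometric (a₀ - ((j + i : ℕ) : ℝ)) b c g = K * ∫ t in (0 : ℝ)..1, f i t := by
    intro i _
    rw [hyperg_eq_const_mul_integral _ b c g hb hbc hg, hfdef]
    simp only
    rw [intervalIntegral.integral_const_mul]
    ring
  have hint : ∀ i ∈ range (k + 1), IntervalIntegrable (f i) MeasureTheory.volume 0 1 := by
    intro i _
    simp only [hfdef]
    exact (intervalIntegrable_euler b c g _ hb hbc hg0 hg1).const_mul _
  rw [sum_congr rfl hterm, ← mul_sum, ← intervalIntegral.integral_finsetSum hint]
  refine mul_nonneg hK (intervalIntegral.integral_nonneg zero_le_one fun t ht => ?_)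
  -- pointwise: Σ_i (−1)^i C(k,i) w(t) (1−gt)^{(j+i) − a₀} = w(t) (1−gt)^{j−a₀} (g t)^k ≥ 0
  have hpos : 0 < 1 - g * t := one_sub_mul_pos_of hg0 hg1 ht
  have hsplit : ∀ i : ℕ, (1 - g * t) ^ (-(a₀ - ((j + i : ℕ) : ℝ))) = (1 - g * t) ^ ((j : ℝ) - a₀) * (1 - g * t) ^ i := by
    intro i
    rw [← Real.rpow_add_natCast hpos.ne']
    congr 1
    push_cast
    ring
  have hf : ∀ i : ℕ, f i t = t ^ (b - 1) * (1 - t) ^ (c - b - 1) * (1 - g * t) ^ ((j : ℝ) - a₀) *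
      ((-1 : ℝ) ^ i * (k.choose i : ℝ) * (1 - g * t) ^ (0 + i)) := by
    intro i
    simp only [hfdef]
    rw [hsplit i, zero_add]
    ring
  simp_rw [hf]
  rw [← mul_sum, MomentRatioTN.altSum_geom (1 - g * t) k 0, pow_zero, one_mul, sub_sub_cancel]
  have h1 : 0 ≤ t ^ (b - 1) := Real.rpow_nonneg ht.1 _
  have h2 : 0 ≤ (1 - t) ^ (c - b - 1) := Real.rpow_nonneg (by linarith [ht.2]) _
  have h3 : 0 ≤ (1 - g * t) ^ ((j : ℝ) - a₀) := Real.rpow_nonneg hpos.le _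
  have h4 : 0 ≤ (g * t) ^ k := pow_nonneg (mul_nonneg hg0 ht.1) k
  positivity

/-- Strict positivity of `F(a,b;c;g)` for `0 < b < c`, `0 ≤ g < 1` (Euler integral of a positive function). -/
theorem hyperg_pos (a b c g : ℝ) (hb : 0 < b) (hbc : b < c) (hg0 : 0 ≤ g) (hg1 : g < 1) :
    0 < ordinaryHypergeometric a b c g := by
  have hg : |g| < 1 := abs_lt.2 ⟨by linarith, hg1⟩
  rw [hyperg_eq_const_mul_integral a b c g hb hbc hg]
  have hΓb := Real.Gamma_pos_of_pos hb
  have hΓcb := Real.Gamma_pos_of_pos (sub_pos.2 hbc)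
  have hΓc := Real.Gamma_pos_of_pos (hb.trans hbc)
  refine mul_pos (by positivity) (intervalIntegral.intervalIntegral_pos_of_pos_on
    (intervalIntegrable_euler b c g _ hb hbc hg0 hg1) (fun t ht => ?_) zero_lt_one)
  have ht' : t ∈ Set.Icc (0 : ℝ) 1 := ⟨ht.1.le, ht.2.le⟩
  have hpos : 0 < 1 - g * t := one_sub_mul_pos_of hg0 hg1 ht'
  have h1 : 0 < t ^ (b - 1) := Real.rpow_pos_of_pos ht.1 _
  have h2 : 0 < (1 - t) ^ (c - b - 1) := Real.rpow_pos_of_pos (by linarith [ht.2]) _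
  have h3 : 0 < (1 - g * t) ^ (-a) := Real.rpow_pos_of_pos hpos _
  positivity


end HypergeomCM

end Summit.CriticalPhenomena.PercolationContinuityZ3.Theorems
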